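import Mathlib
import HarnessLib

/-!
# Crux K2 `PoloidalWindowRigidity` (stmt-NavierStokesRegularity-19708), line `z_shock` — R3 infrastructure: SMOOTH LOCALISATION OF
# THE SLOPE FUNCTION near a compact interval of values (`G ↦ G̃ ∈ C^∞(ℝ)`, `G̃ = G` near `[α, β]`)

`--supports stmt-NavierStokesRegularity-19708 --as helper` (leafhand-ns-poloidalwindowdoor-3 g6, cell decomp-ns, 2026-08-31).
**No stub and no summit is closed by this file; Navier–Stokes regularity is NOT proved here (rung 0).**

WHY THIS FILE.  The typed entrance of rung R3, `…ZShockHeightEvolution.heightEvolution_of_class_autonomy`, produces on each non-degenerate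
component `Ω` of the slice ONE slope function `G : ℝ → ℝ` that is real-analytic AT THE VALUES `v₂(x)`, `x ∈ Ω` — as a function on `ℝ` it
is arbitrary away from the value set.  The energy files of the R3 infrastructure (`…ZShockWaveLocalEnergy`, `…ZShockWaveLocalEnergyLocal`:
wave-energy balance, cone-local energy inequality, with `γ = −G`) take `γ ∈ C^∞(ℝ)` GLOBALLY (the energy density `½wₛ² + ½γ(w)|∇w|²`
must be a jointly smooth space–time field).  This file supplies the missing glue, elementary and Mathlib-only: on a compact connected
piece `K` of the chart of `Ω` (a solid cone) the values form a compact interval `[α, β]` at each point of which `G` is analytic, and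

* `exists_Icc_cthickening_subset_analyticAt` — analyticity persists on a uniform collar `[α − δ, β + δ]` (the analyticity locus is open,
  `isOpen_analyticAt`; compactness, `IsCompact.exists_cthickening_subset_open`);
* `contDiff_plateau`, `plateau_eq_one`, `plateau_eq_zero_of_le`, `plateau_eq_zero_of_ge` — the double `Real.smoothTransition` plateau
  `r ↦ χ((r − (α−2ε))/ε)·χ(((β+2ε) − r)/ε)`: smooth, `= 1` on `[α − ε, β + ε]`, `= 0` off `(α − 2ε, β + 2ε)`;
* `exists_contDiff_eqOn_nhds_Icc` — THE LEMMA: if `G` is analytic at every point of `[α, β]` (`α ≤ β`) there are `G̃ ∈ C^∞(ℝ)` and `ε > 0`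
  with `G̃ = G` on the open collar `(α − ε, β + ε)`; hence (`deriv_eq_of_eqOn_Ioo`, `hasDerivAt_of_eqOn_Ioo`) `G̃' = G'` and
  `HasDerivAt G̃ (deriv G r) r` there — so `heightEvolution_of_class_autonomy`'s conclusion on `K` can be read with `G̃` in place of `G`
  and fed to `…ZShockSliceTyping.slice_wave_pde_field` / `…ZShockWaveLocalEnergyLocal.waveEnergy_closedBall_le_exp_mul_local` with
  `γ = −G̃ ∈ C^∞(ℝ)`.

Bookkeeping-grade; proves no rigidity.  presearch: none needed (smooth cutoff). [folklore]
-/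

noncomputable section

namespace Summit.NavierStokesRegularity.NavierStokesRegularity.Theorems.PoloidalWindowDoorPoloidalWindowRigidityZShockSlopeSmoothCutoff

-- the problem directory repeats the summit name (`NavierStokesRegularity/NavierStokesRegularity`)
set_option linter.dupNamespace false

open Set Filter Topology Metric
open scoped ContDiff

/-! ### A uniform collar of analyticity around a compact interval of values -/

/-- If `G` is analytic at every point of `[α, β]`, it is analytic at every point of a uniform collar `[α − δ, β + δ]`, `δ > 0`.
[folklore] -/
theorem exists_Icc_cthickening_subset_analyticAt {G : ℝ → ℝ} {α β : ℝ} (hαβ : α ≤ β)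
    (hG : ∀ r ∈ Icc α β, AnalyticAt ℝ G r) :
    ∃ δ > 0, ∀ r ∈ Icc (α - δ) (β + δ), AnalyticAt ℝ G r := by
  obtain ⟨δ, hδ, hsub⟩ := (isCompact_Icc (a := α) (b := β)).exists_cthickening_subset_open
    (isOpen_analyticAt ℝ G) (fun r hr => hG r hr)
  refine ⟨δ, hδ, fun r hr => hsub ?_⟩
  -- `r` is within `δ` of the nearest point `max α (min r β)` of `[α, β]`
  refine mem_cthickening_of_dist_le r (max α (min r β)) δ (Icc α β) ⟨le_max_left _ _, max_le hαβ (min_le_right _ _)⟩ ?_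
  rw [Real.dist_eq, abs_le]
  rcases le_total r α with h | h
  · rw [min_eq_left (h.trans hαβ), max_eq_left h]
    constructor <;> linarith [hr.1]
  · rw [max_eq_right (le_min h hαβ)]
    rcases le_total r β with h' | h'
    · rw [min_eq_left h']
      constructor <;> linarith
    · rw [min_eq_right h']
      constructor <;> linarith [hr.2]

/-! ### The smooth plateau -/

/-- The double-transition plateau `r ↦ χ((r − a)/ε)·χ((b − r)/ε)` (`χ = Real.smoothTransition`) is smooth. [folklore] -/
theorem contDiff_plateau (a b ε : ℝ) {n : ℕ∞} :
    ContDiff ℝ n fun r : ℝ => Real.smoothTransition ((r - a) / ε) * Real.smoothTransition ((b - r) / ε) :=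
  (Real.smoothTransition.contDiff.comp ((contDiff_id.sub contDiff_const).div_const ε)).mul
    (Real.smoothTransition.contDiff.comp ((contDiff_const.sub contDiff_id).div_const ε))

/-- The plateau equals `1` on `[a + ε, b − ε]` (`ε > 0`). [folklore] -/
theorem plateau_eq_one {a b ε r : ℝ} (hε : 0 < ε) (h1 : a + ε ≤ r) (h2 : r ≤ b - ε) :
    Real.smoothTransition ((r - a) / ε) * Real.smoothTransition ((b - r) / ε) = 1 := by
  rw [Real.smoothTransition.one_of_one_le ((one_le_div hε).2 (by linarith)),
    Real.smoothTransition.one_of_one_le ((one_le_div hε).2 (by linarith)), one_mul]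

/-- The plateau vanishes on `(−∞, a]` (`ε > 0`). [folklore] -/
theorem plateau_eq_zero_of_le {a b ε r : ℝ} (hε : 0 < ε) (h : r ≤ a) :
    Real.smoothTransition ((r - a) / ε) * Real.smoothTransition ((b - r) / ε) = 0 := by
  rw [Real.smoothTransition.zero_of_nonpos (div_nonpos_of_nonpos_of_nonneg (by linarith) hε.le), zero_mul]

/-- The plateau vanishes on `[b, ∞)` (`ε > 0`). [folklore] -/
theorem plateau_eq_zero_of_ge {a b ε r : ℝ} (hε : 0 < ε) (h : b ≤ r) :
    Real.smoothTransition ((r - a) / ε) * Real.smoothTransition ((b - r) / ε) = 0 := by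
  have h0 : Real.smoothTransition ((b - r) / ε) = 0 :=
    Real.smoothTransition.zero_of_nonpos (div_nonpos_of_nonpos_of_nonneg (by linarith) hε.le)
  rw [h0, mul_zero]

/-! ### Smooth localisation of a function analytic near a compact interval -/

/-- **Smooth localisation near a compact interval.**  If `G : ℝ → ℝ` is real-analytic at every point of `[α, β]` (`α ≤ β`), there are a
GLOBALLY smooth `G̃ : ℝ → ℝ` and `ε > 0` such that `G̃ = G` on the open collar `(α − ε, β + ε)`.  (Take a collar `[α − 3ε, β + 3ε]` of
analyticity and `G̃ = plateau · G` with the plateau `= 1` on `[α − ε, β + ε]`, `= 0` off `(α − 2ε, β + 2ε)`.) [folklore] -/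
theorem exists_contDiff_eqOn_nhds_Icc {G : ℝ → ℝ} {α β : ℝ} (hαβ : α ≤ β)
    (hG : ∀ r ∈ Icc α β, AnalyticAt ℝ G r) :
    ∃ Gs : ℝ → ℝ, ContDiff ℝ ∞ Gs ∧ ∃ ε > 0, ∀ r ∈ Ioo (α - ε) (β + ε), Gs r = G r := by
  obtain ⟨δ, hδ, hGδ⟩ := exists_Icc_cthickening_subset_analyticAt hαβ hG
  set ε : ℝ := δ / 3 with hε
  have hεpos : 0 < ε := by rw [hε]; positivity
  -- the plateau: `1` on `[α - ε, β + ε]`, `0` off `(α - 2ε, β + 2ε)`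
  set p : ℝ → ℝ := fun r => Real.smoothTransition ((r - (α - 2 * ε)) / ε) * Real.smoothTransition (((β + 2 * ε) - r) / ε)
    with hp
  have hpC : ContDiff ℝ ∞ p := contDiff_plateau (α - 2 * ε) (β + 2 * ε) ε
  refine ⟨fun r => p r * G r, ?_, ε, hεpos, fun r hr => ?_⟩
  · -- smoothness: near a point of the analyticity collar it is a product of smooth functions; elsewhere it vanishes identically nearby
    rw [contDiff_iff_contDiffAt]
    intro r
    by_cases hin : r ∈ Ioo (α - 3 * ε) (β + 3 * ε)
    · have hrδ : r ∈ Icc (α - δ) (β + δ) := by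
        constructor <;> [linarith [hin.1]; linarith [hin.2]]
      exact hpC.contDiffAt.mul (hGδ r hrδ).contDiffAt
    · -- `r ≤ α - 3ε` or `r ≥ β + 3ε`: the plateau vanishes on a neighbourhood of `r`
      rw [mem_Ioo, not_and_or, not_lt, not_lt] at hin
      have hzero : (fun r' => p r' * G r') =ᶠ[𝓝 r] fun _ => 0 := by
        rcases hin with h | h
        · filter_upwards [Iio_mem_nhds (show r < α - 2 * ε by linarith)] with r' hr'
          rw [hp]
          simp only
          rw [plateau_eq_zero_of_le hεpos (le_of_lt hr'), zero_mul]
        · filter_upwards [Ioi_mem_nhds (show β + 2 * ε < r by linarith)] with r' hr'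
          rw [hp]
          simp only
          rw [plateau_eq_zero_of_ge hεpos (le_of_lt hr'), zero_mul]
      exact (contDiffAt_const (c := (0 : ℝ))).congr_of_eventuallyEq hzero
  · -- agreement on the collar `(α - ε, β + ε)`, where the plateau is `1`
    simp only [hp]
    rw [plateau_eq_one hεpos (by linarith [hr.1]) (by linarith [hr.2]), one_mul]

/-- On the open collar where `G̃ = G`, the derivatives agree. [folklore] -/
theorem deriv_eq_of_eqOn_Ioo {G Gs : ℝ → ℝ} {a b r : ℝ} (heq : ∀ r' ∈ Ioo a b, Gs r' = G r') (hr : r ∈ Ioo a b) :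
    deriv Gs r = deriv G r :=
  Filter.EventuallyEq.deriv_eq (Filter.eventuallyEq_of_mem (Ioo_mem_nhds hr.1 hr.2) fun r' hr' => heq r' hr')

/-- On the open collar where `G̃ = G`, `G̃` has the derivative of `G` wherever `G` is differentiable (e.g. analytic). [folklore] -/
theorem hasDerivAt_of_eqOn_Ioo {G Gs : ℝ → ℝ} {a b r : ℝ} (heq : ∀ r' ∈ Ioo a b, Gs r' = G r') (hr : r ∈ Ioo a b)
    (hG : DifferentiableAt ℝ G r) : HasDerivAt Gs (deriv G r) r :=
  hG.hasDerivAt.congr_of_eventuallyEq (Filter.eventuallyEq_of_mem (Ioo_mem_nhds hr.1 hr.2) fun r' hr' => heq r' hr')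

/-- **Packaged for the R3 entrance.**  If `G` is analytic at every point of `[α, β]` (`α ≤ β`), there are `G̃ ∈ C^∞(ℝ)` and `ε > 0` such
that on the open collar `(α − ε, β + ε)`: `G̃ = G`, `deriv G̃ = deriv G`, and `HasDerivAt G̃ (deriv G r) r`.  With `[α, β]` the value
interval of the slice on a compact connected piece of a non-degenerate component, this turns the slope function of
`…ZShockHeightEvolution.heightEvolution_of_class_autonomy` into the globally smooth `γ = −G̃` required by the energy files. [folklore] -/
theorem exists_contDiff_localisation {G : ℝ → ℝ} {α β : ℝ} (hαβ : α ≤ β)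
    (hG : ∀ r ∈ Icc α β, AnalyticAt ℝ G r) :
    ∃ Gs : ℝ → ℝ, ContDiff ℝ ∞ Gs ∧ ∃ ε > 0, ∀ r ∈ Ioo (α - ε) (β + ε),
      Gs r = G r ∧ deriv Gs r = deriv G r ∧ HasDerivAt Gs (deriv G r) r := by
  obtain ⟨δ, hδ, hGδ⟩ := exists_Icc_cthickening_subset_analyticAt hαβ hG
  obtain ⟨Gs, hGs, ε, hε, heq⟩ := exists_contDiff_eqOn_nhds_Icc hαβ hG
  -- shrink the collar so that `G` is analytic (hence differentiable) on it
  refine ⟨Gs, hGs, min ε δ, lt_min hε hδ, fun r hr => ?_⟩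
  have hrε : r ∈ Ioo (α - ε) (β + ε) := by
    constructor <;> [linarith [hr.1, min_le_left ε δ]; linarith [hr.2, min_le_left ε δ]]
  have hrδ : r ∈ Icc (α - δ) (β + δ) := by
    constructor <;> [linarith [hr.1, min_le_right ε δ]; linarith [hr.2, min_le_right ε δ]]
  exact ⟨heq r hrε, deriv_eq_of_eqOn_Ioo heq hrε,
    hasDerivAt_of_eqOn_Ioo heq hrε (hGδ r hrδ).differentiableAt⟩

end Summit.NavierStokesRegularity.NavierStokesRegularity.Theorems.PoloidalWindowDoorPoloidalWindowRigidityZShockSlopeSmoothCutoff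

end
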